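import Summits.RiemannHypothesis.RiemannHypothesis.Theorems.WeilTwoPrimeDeflM80XBase
import Literature.NumberTheory.LFunctions.WeilBlockRows
import Literature.NumberTheory.LFunctions.WeilBlockRowsPZ
import Summits.RiemannHypothesis.RiemannHypothesis.Theorems.WeilTwoPrimeDeflM80PDataDnE18
import HarnessLib

/-!
# Calibration certificate M80X: rows 42–47 of the even `D C = I` and rows 58–61 of the claim `D = Dn / Ls` for M80P's factored even inverse

`WeilCert.checkDCRow 0` (6 rows) and `WeilCert.checkDnRow` (4 rows, `weilCertDeflM80XDnE` / `weilCertDeflM80PLsE`) for certificate M80X, by `decide +kernel` (gen3 re-split: ≤ 6 DC rows per file for the gate's 600-s elaboration cap under the farm's load variance). Pure proof file.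
-/

set_option linter.dupNamespace false

noncomputable section

namespace Summit.RiemannHypothesis.RiemannHypothesis.Theorems.EvenWinsBeyondArch

open Literature.NumberTheory.LFunctions

set_option maxHeartbeats 0 in
/-- Kernel check of row 42 of the even `D C = I` (certificate M80X). [folklore] -/
theorem checkDCRow0_42_weilCertDeflM80X : weilCertDeflM80XBase.checkDCRow 0 42 = true := by
  decide +kernel

set_option maxHeartbeats 0 in
/-- Kernel check of row 43 of the even `D C = I` (certificate M80X). [folklore] -/
theorem checkDCRow0_43_weilCertDeflM80X : weilCertDeflM80XBase.checkDCRow 0 43 = true := by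
  decide +kernel

set_option maxHeartbeats 0 in
/-- Kernel check of row 44 of the even `D C = I` (certificate M80X). [folklore] -/
theorem checkDCRow0_44_weilCertDeflM80X : weilCertDeflM80XBase.checkDCRow 0 44 = true := by
  decide +kernel

set_option maxHeartbeats 0 in
/-- Kernel check of row 45 of the even `D C = I` (certificate M80X). [folklore] -/
theorem checkDCRow0_45_weilCertDeflM80X : weilCertDeflM80XBase.checkDCRow 0 45 = true := by
  decide +kernel

set_option maxHeartbeats 0 in
/-- Kernel check of row 46 of the even `D C = I` (certificate M80X). [folklore] -/
theorem checkDCRow0_46_weilCertDeflM80X : weilCertDeflM80XBase.checkDCRow 0 46 = true := by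
  decide +kernel

set_option maxHeartbeats 0 in
/-- Kernel check of row 47 of the even `D C = I` (certificate M80X). [folklore] -/
theorem checkDCRow0_47_weilCertDeflM80X : weilCertDeflM80XBase.checkDCRow 0 47 = true := by
  decide +kernel

-- ===== factored even inverse `D = Dn / Ls`: rows 58–61 =====
set_option maxHeartbeats 0 in
/-- Row 58 of `DnE/LsE` is row 58 of the even `D` (certificate M80X). [folklore] -/
theorem checkDnRow0_58_weilCertDeflM80X : weilCertDeflM80XBase.checkDnRow weilCertDeflM80XDnE weilCertDeflM80PLsE 0 58 = true := by
  decide +kernel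

set_option maxHeartbeats 0 in
/-- Row 59 of `DnE/LsE` is row 59 of the even `D` (certificate M80X). [folklore] -/
theorem checkDnRow0_59_weilCertDeflM80X : weilCertDeflM80XBase.checkDnRow weilCertDeflM80XDnE weilCertDeflM80PLsE 0 59 = true := by
  decide +kernel

set_option maxHeartbeats 0 in
/-- Row 60 of `DnE/LsE` is row 60 of the even `D` (certificate M80X). [folklore] -/
theorem checkDnRow0_60_weilCertDeflM80X : weilCertDeflM80XBase.checkDnRow weilCertDeflM80XDnE weilCertDeflM80PLsE 0 60 = true := by
  decide +kernel

set_option maxHeartbeats 0 in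
/-- Row 61 of `DnE/LsE` is row 61 of the even `D` (certificate M80X). [folklore] -/
theorem checkDnRow0_61_weilCertDeflM80X : weilCertDeflM80XBase.checkDnRow weilCertDeflM80XDnE weilCertDeflM80PLsE 0 61 = true := by
  decide +kernel

end Summit.RiemannHypothesis.RiemannHypothesis.Theorems.EvenWinsBeyondArch

end
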